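import Literature.NumberTheory.Sieve.SmoothParityModelCount
import HarnessLib

/-!
# The model count of the parity ternary problem: the sublattice sums have density `1/t²`

Topic `Literature/NumberTheory/Sieve`, namespace `Literature.NumberTheory.Sieve.SmoothArcs`; a PROVED tool file for the
circle-method engine of `SmoothParityTernary` ([Harper2016, §5]), sequel of `SmoothParityModelCount` (notation
`MC = parityModelCount …`, `SUB_t` = its sublattice sum over `t ∣ n₁, n₂, n₃`, `μ_i(n) = (Mv_i/X_i) g_i(n/X_i)` with
`g_i(v) = v^{α−1} p_{c_i}(v)`).

* `parityModelCount_eq_sum_sum_of_eq`, `parityModel_sublattice_eq_sum_sum_of_eq`: `MC` and `SUB_t` as double sums of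
  the single function `Gr(u₁,u₂) = (ΠMv_i/X_i) g₁(u₁/X₁) g₂(u₂/X₂) conj g₃((d₁u₁+σd₂u₂)/X₃)` over `[1,X₁]×[1,X₂]` resp. its
  sublattice `tℕ × tℕ` (the `g_i`, `Gr` enter through defining hypotheses `hg_i`, `hGr`, to keep statements short);
* (MC2) `norm_sq_mul_sublattice_sub_parityModelCount_le`: for profiles vanishing on `v ≤ 1/4`, `|p| ≤ 1`, `L`-Lipschitz,
  `0 ≤ α ≤ 1`, `Mv_i ≥ 0`, `σ = ±1`, `1 ≤ t ≤ X₁, X₂`, `X₃ > 0`: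
  `‖t² SUB_t − MC‖ ≤ 1024 (L+1)(d₁+d₂+1) · t · (Mv₁Mv₂Mv₃/X₃)(1/X₁ + 1/X₂ + 1/X₃)`
  (block lemma of `SmoothParityModelCountLemmas`: `Gr` oscillates by `O((L+1) t (1/X₁+1/X₂+(d₁+d₂)/X₃) ΠMv_i/X_i)` on
  `t×t` blocks and there are `≤ 4X₁X₂` terms);
* (MC1)+(MC2) `norm_parityModelCount_rescale_sub_le` (`'`: masses `t^{−α} Mv_i`): `MC(X_i/t, Mv_i t^{−α}) =
  t (t^{−α})³ (MC + O(…))`, the form in which the count of solutions with all variables divisible by `t` is compared with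
  `t^{1−3α}` times the full count.

## References

* A. J. Harper, Compositio Math. 152 (2016), §5 [Harper2016].
-/

noncomputable section

open Finset

namespace Literature.NumberTheory.Sieve

namespace SmoothArcs

variable {c₁ c₂ c₃ : ℤ → ℂ}

/-! ### The model count and its sublattice sums in `g`-form -/

/-- The collapsed third factor in `g`-form: for `s ∈ ℤ`, `X₃ > 0` and `g₃(v) = v^{α−1} p_{c₃}(v)`,
`Σ_{n₃=1}^{⌊X₃⌋} 1[s = n₃] A conj μ₃(n₃) = A (Mv₃/X₃) conj g₃(s/X₃)` (both vanish unless `1 ≤ s ≤ ⌊X₃⌋`, since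
`p_{c₃} = 0` off `(0,1]`). [folklore] -/
theorem sum_Icc_ite_conj_profileModelWeight_eq {g₃ : ℝ → ℂ} {α : ℝ}
    (hg₃ : ∀ v, g₃ v = (((v ^ (α - 1) : ℝ)) : ℂ) * profileFn c₃ v) {X₃ : ℝ} (hX₃ : 0 < X₃) (Mv₃ : ℝ)
    (A : ℂ) (s : ℤ) :
    ∑ n₃ ∈ Icc 1 ⌊X₃⌋₊, (if s = (n₃ : ℤ) then A * starRingEnd ℂ (profileModelWeight c₃ Mv₃ X₃ α n₃) else 0) =
      A * (((Mv₃ / X₃ : ℝ) : ℂ) * starRingEnd ℂ (g₃ ((s : ℝ) / X₃))) := by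
  rw [sum_Icc_ite_intCast_eq]
  by_cases hc : 1 ≤ s ∧ s ≤ ⌊X₃⌋₊
  · rw [if_pos hc, profileModelWeight_eq_mul_rpow_mul, ← hg₃]
    have hs : ((s.toNat : ℕ) : ℝ) = (s : ℝ) := by
      have h := Int.toNat_of_nonneg (show 0 ≤ s by omega)
      exact_mod_cast congrArg (fun z : ℤ => (z : ℝ)) h
    rw [hs, map_mul, Complex.conj_ofReal]
  · rw [if_neg hc]
    have hv : (s : ℝ) / X₃ ∉ Set.Ioc (0 : ℝ) 1 := by
      rintro ⟨h0, h1⟩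
      refine hc ⟨?_, ?_⟩
      · have h : (0 : ℝ) < s := by
          have h' := mul_pos h0 hX₃
          rwa [div_mul_cancel₀ _ hX₃.ne'] at h'
        have h2 : (0 : ℤ) < s := by exact_mod_cast h
        omega
      · have h2 : (s : ℝ) ≤ X₃ := by rwa [div_le_one hX₃] at h1
        have h3 : (s : ℝ) < (⌊X₃⌋₊ : ℕ) + 1 := h2.trans_lt (Nat.lt_floor_add_one X₃)
        have h4 : s < (⌊X₃⌋₊ : ℤ) + 1 := by exact_mod_cast h3
        omega
    rw [hg₃, profileFn_of_not_mem hv, mul_zero, map_zero, mul_zero, mul_zero]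

/-- **The model count in `g`-form**: with `g_i(v) = v^{α−1} p_{c_i}(v)` and
`Gr(u₁, u₂) = (ΠMv_i/X_i) g₁(u₁/X₁) g₂(u₂/X₂) conj g₃((d₁u₁ + σd₂u₂)/X₃)`,
`parityModelCount = Σ_{n₁=1}^{⌊X₁⌋} Σ_{n₂=1}^{⌊X₂⌋} Gr(n₁, n₂)` (`X₃ > 0`). [cite: Harper2016, §5] -/
theorem parityModelCount_eq_sum_sum_of_eq {σ : ℤ} {d₁ d₂ : ℕ} {X₁ X₂ X₃ Mv₁ Mv₂ Mv₃ α : ℝ}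
    {g₁ g₂ g₃ : ℝ → ℂ} {Gr : ℝ → ℝ → ℂ}
    (hg₁ : ∀ v, g₁ v = (((v ^ (α - 1) : ℝ)) : ℂ) * profileFn c₁ v)
    (hg₂ : ∀ v, g₂ v = (((v ^ (α - 1) : ℝ)) : ℂ) * profileFn c₂ v)
    (hg₃ : ∀ v, g₃ v = (((v ^ (α - 1) : ℝ)) : ℂ) * profileFn c₃ v)
    (hGr : ∀ u₁ u₂, Gr u₁ u₂ = ((Mv₁ / X₁ * (Mv₂ / X₂) * (Mv₃ / X₃) : ℝ) : ℂ) *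
      (g₁ (u₁ / X₁) * g₂ (u₂ / X₂) * starRingEnd ℂ (g₃ ((d₁ * u₁ + σ * (d₂ * u₂)) / X₃))))
    (hX₃ : 0 < X₃) :
    parityModelCount σ d₁ d₂ X₁ X₂ X₃ Mv₁ Mv₂ Mv₃ α c₁ c₂ c₃ =
      ∑ n₁ ∈ Icc 1 ⌊X₁⌋₊, ∑ n₂ ∈ Icc 1 ⌊X₂⌋₊, Gr n₁ n₂ := by
  unfold parityModelCount
  refine Finset.sum_congr rfl fun n₁ _ => Finset.sum_congr rfl fun n₂ _ => ?_
  rw [sum_Icc_ite_conj_profileModelWeight_eq hg₃ hX₃ Mv₃ _ _, hGr, profileModelWeight_eq_mul_rpow_mul,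
    profileModelWeight_eq_mul_rpow_mul, ← hg₁, ← hg₂]
  push_cast
  ring

/-- **The sublattice sum in `g`-form**: for `t ≥ 1`, with the notation of `parityModelCount_eq_sum_sum_of_eq`,
`Σ_{t ∣ n₁, n₂, n₃} 1[d₁n₁ + σd₂n₂ = n₃] μ₁ μ₂ conj μ₃ = Σ_{m₁ ≤ ⌊X₁⌋/t} Σ_{m₂ ≤ ⌊X₂⌋/t} Gr(tm₁, tm₂)` (the filter
`t ∣ n₃` is implied by the equation). [cite: Harper2016, §5] -/
theorem parityModel_sublattice_eq_sum_sum_of_eq {σ : ℤ} {d₁ d₂ : ℕ} {X₁ X₂ X₃ Mv₁ Mv₂ Mv₃ α : ℝ}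
    {g₁ g₂ g₃ : ℝ → ℂ} {Gr : ℝ → ℝ → ℂ}
    (hg₁ : ∀ v, g₁ v = (((v ^ (α - 1) : ℝ)) : ℂ) * profileFn c₁ v)
    (hg₂ : ∀ v, g₂ v = (((v ^ (α - 1) : ℝ)) : ℂ) * profileFn c₂ v)
    (hg₃ : ∀ v, g₃ v = (((v ^ (α - 1) : ℝ)) : ℂ) * profileFn c₃ v)
    (hGr : ∀ u₁ u₂, Gr u₁ u₂ = ((Mv₁ / X₁ * (Mv₂ / X₂) * (Mv₃ / X₃) : ℝ) : ℂ) *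
      (g₁ (u₁ / X₁) * g₂ (u₂ / X₂) * starRingEnd ℂ (g₃ ((d₁ * u₁ + σ * (d₂ * u₂)) / X₃))))
    (hX₃ : 0 < X₃) {t : ℕ} (ht : 0 < t) :
    (∑ n₁ ∈ (Icc 1 ⌊X₁⌋₊).filter (t ∣ ·), ∑ n₂ ∈ (Icc 1 ⌊X₂⌋₊).filter (t ∣ ·),
      ∑ n₃ ∈ (Icc 1 ⌊X₃⌋₊).filter (t ∣ ·),
        if (d₁ * n₁ : ℤ) + σ * (d₂ * n₂) = n₃ then
          profileModelWeight c₁ Mv₁ X₁ α n₁ * profileModelWeight c₂ Mv₂ X₂ α n₂ *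
            starRingEnd ℂ (profileModelWeight c₃ Mv₃ X₃ α n₃)
        else 0) =
      ∑ m₁ ∈ Icc 1 (⌊X₁⌋₊ / t), ∑ m₂ ∈ Icc 1 (⌊X₂⌋₊ / t), Gr ((t * m₁ : ℕ) : ℝ) ((t * m₂ : ℕ) : ℝ) := by
  calc (∑ n₁ ∈ (Icc 1 ⌊X₁⌋₊).filter (t ∣ ·), ∑ n₂ ∈ (Icc 1 ⌊X₂⌋₊).filter (t ∣ ·),
        ∑ n₃ ∈ (Icc 1 ⌊X₃⌋₊).filter (t ∣ ·),
          if (d₁ * n₁ : ℤ) + σ * (d₂ * n₂) = n₃ then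
            profileModelWeight c₁ Mv₁ X₁ α n₁ * profileModelWeight c₂ Mv₂ X₂ α n₂ *
              starRingEnd ℂ (profileModelWeight c₃ Mv₃ X₃ α n₃)
          else 0)
      = ∑ n₁ ∈ (Icc 1 ⌊X₁⌋₊).filter (t ∣ ·), ∑ n₂ ∈ (Icc 1 ⌊X₂⌋₊).filter (t ∣ ·), Gr n₁ n₂ := by
        refine Finset.sum_congr rfl fun n₁ hn₁ => Finset.sum_congr rfl fun n₂ hn₂ => ?_
        have ht₁ : (t : ℤ) ∣ (n₁ : ℤ) := Int.natCast_dvd_natCast.mpr (Finset.mem_filter.mp hn₁).2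
        have ht₂ : (t : ℤ) ∣ (n₂ : ℤ) := Int.natCast_dvd_natCast.mpr (Finset.mem_filter.mp hn₂).2
        have hdvd : (t : ℤ) ∣ (d₁ * n₁ : ℤ) + σ * (d₂ * n₂) :=
          (ht₁.mul_left _).add ((ht₂.mul_left _).mul_left _)
        rw [sum_filter_dvd_ite_intCast_eq _ _ hdvd, sum_Icc_ite_conj_profileModelWeight_eq hg₃ hX₃ Mv₃ _ _, hGr,
          profileModelWeight_eq_mul_rpow_mul, profileModelWeight_eq_mul_rpow_mul, ← hg₁, ← hg₂]
        push_cast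
        ring
    _ = ∑ m₁ ∈ Icc 1 (⌊X₁⌋₊ / t), ∑ m₂ ∈ Icc 1 (⌊X₂⌋₊ / t), Gr ((t * m₁ : ℕ) : ℝ) ((t * m₂ : ℕ) : ℝ) := by
        simp only [sum_filter_dvd_Icc_eq_sum _ _ ht]

/-! ### (MC2) The sublattice sums have density `1/t²` -/

/-- **(MC2) Sublattice density.**  For profiles vanishing on `v ≤ 1/4` with `|p_{c_i}| ≤ 1` and
`|p_{c_i}(v) − p_{c_i}(w)| ≤ L|v − w|`, `0 ≤ α ≤ 1`, `Mv_i ≥ 0`, `σ = ±1`, `1 ≤ t ≤ X₁, X₂`, `X₃ > 0`: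
`‖t² Σ_{t ∣ n₁,n₂,n₃} 1[d₁n₁+σd₂n₂ = n₃] μ₁μ₂ conj μ₃ − parityModelCount‖
   ≤ 1024 (L+1)(d₁+d₂+1) · t · (Mv₁Mv₂Mv₃/X₃)(1/X₁ + 1/X₂ + 1/X₃)`.
Proof: in `g`-form both are double sums of `Gr` (bounded oscillation `16(4L+16) t (1/X₁ + 1/X₂ + (d₁+d₂)/X₃) ΠMv_i/X_i`
on `t × t` blocks, `norm_gTerm_sub_le`) over `[1, tK₁] × [1, tK₂]` resp. its sublattice, `tK_i ≤ 2X_i`; apply the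
block lemma `norm_sum_sub_sq_mul_sum_le`. [cite: Harper2016, §5] -/
theorem norm_sq_mul_sublattice_sub_parityModelCount_le {σ : ℤ} (hσ : σ = 1 ∨ σ = -1) (d₁ d₂ : ℕ)
    {X₁ X₂ X₃ Mv₁ Mv₂ Mv₃ α L : ℝ} (hα0 : 0 ≤ α) (hα1 : α ≤ 1) (hMv₁ : 0 ≤ Mv₁) (hMv₂ : 0 ≤ Mv₂)
    (hMv₃ : 0 ≤ Mv₃) (hX₃ : 0 < X₃) {t : ℕ} (ht : 0 < t) (htX₁ : (t : ℝ) ≤ X₁) (htX₂ : (t : ℝ) ≤ X₂)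
    (h0₁ : ∀ v : ℝ, v ≤ 1 / 4 → profileFn c₁ v = 0) (h0₂ : ∀ v : ℝ, v ≤ 1 / 4 → profileFn c₂ v = 0)
    (h0₃ : ∀ v : ℝ, v ≤ 1 / 4 → profileFn c₃ v = 0)
    (h1₁ : ∀ v, ‖profileFn c₁ v‖ ≤ 1) (h1₂ : ∀ v, ‖profileFn c₂ v‖ ≤ 1) (h1₃ : ∀ v, ‖profileFn c₃ v‖ ≤ 1)
    (hL₁ : ∀ v w, ‖profileFn c₁ v - profileFn c₁ w‖ ≤ L * |v - w|)
    (hL₂ : ∀ v w, ‖profileFn c₂ v - profileFn c₂ w‖ ≤ L * |v - w|)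
    (hL₃ : ∀ v w, ‖profileFn c₃ v - profileFn c₃ w‖ ≤ L * |v - w|) :
    ‖(t : ℂ) ^ 2 *
          (∑ n₁ ∈ (Icc 1 ⌊X₁⌋₊).filter (t ∣ ·), ∑ n₂ ∈ (Icc 1 ⌊X₂⌋₊).filter (t ∣ ·),
            ∑ n₃ ∈ (Icc 1 ⌊X₃⌋₊).filter (t ∣ ·),
              if (d₁ * n₁ : ℤ) + σ * (d₂ * n₂) = n₃ then
                profileModelWeight c₁ Mv₁ X₁ α n₁ * profileModelWeight c₂ Mv₂ X₂ α n₂ *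
                  starRingEnd ℂ (profileModelWeight c₃ Mv₃ X₃ α n₃)
              else 0) -
        parityModelCount σ d₁ d₂ X₁ X₂ X₃ Mv₁ Mv₂ Mv₃ α c₁ c₂ c₃‖ ≤
      1024 * (L + 1) * (d₁ + d₂ + 1) * t * (Mv₁ * Mv₂ * Mv₃ / X₃) * (1 / X₁ + 1 / X₂ + 1 / X₃) := by
  have ht1 : (1 : ℝ) ≤ t := by exact_mod_cast ht
  have hX₁ : 0 < X₁ := by linarith
  have hX₂ : 0 < X₂ := by linarith
  have hL0 : 0 ≤ L := lipschitz_const_nonneg hL₁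
  -- the functions `g_i` and the term `Gr`
  obtain ⟨g₁, hg₁⟩ : ∃ g : ℝ → ℂ, ∀ v, g v = (((v ^ (α - 1) : ℝ)) : ℂ) * profileFn c₁ v := ⟨_, fun _ => rfl⟩
  obtain ⟨g₂, hg₂⟩ : ∃ g : ℝ → ℂ, ∀ v, g v = (((v ^ (α - 1) : ℝ)) : ℂ) * profileFn c₂ v := ⟨_, fun _ => rfl⟩
  obtain ⟨g₃, hg₃⟩ : ∃ g : ℝ → ℂ, ∀ v, g v = (((v ^ (α - 1) : ℝ)) : ℂ) * profileFn c₃ v := ⟨_, fun _ => rfl⟩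
  have hP0 : 0 ≤ Mv₁ / X₁ * (Mv₂ / X₂) * (Mv₃ / X₃) := by positivity
  obtain ⟨Gr, hGr⟩ : ∃ Gr : ℝ → ℝ → ℂ, ∀ u₁ u₂, Gr u₁ u₂ = ((Mv₁ / X₁ * (Mv₂ / X₂) * (Mv₃ / X₃) : ℝ) : ℂ) *
      (g₁ (u₁ / X₁) * g₂ (u₂ / X₂) * starRingEnd ℂ (g₃ ((d₁ * u₁ + σ * (d₂ * u₂)) / X₃))) :=
    ⟨_, fun _ _ => rfl⟩
  -- bounds for the `g_i`
  have hb₁ : ∀ v, ‖g₁ v‖ ≤ 4 := fun v => by rw [hg₁]; exact norm_rpow_mul_profileFn_le h0₁ h1₁ hα0 hα1 v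
  have hb₂ : ∀ v, ‖g₂ v‖ ≤ 4 := fun v => by rw [hg₂]; exact norm_rpow_mul_profileFn_le h0₂ h1₂ hα0 hα1 v
  have hb₃ : ∀ v, ‖g₃ v‖ ≤ 4 := fun v => by rw [hg₃]; exact norm_rpow_mul_profileFn_le h0₃ h1₃ hα0 hα1 v
  have hl₁ : ∀ v w, ‖g₁ v - g₁ w‖ ≤ (4 * L + 16) * |v - w| := fun v w => by
    rw [hg₁, hg₁]; exact norm_rpow_mul_profileFn_sub_le h0₁ h1₁ hL₁ hα0 hα1 v w
  have hl₂ : ∀ v w, ‖g₂ v - g₂ w‖ ≤ (4 * L + 16) * |v - w| := fun v w => by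
    rw [hg₂, hg₂]; exact norm_rpow_mul_profileFn_sub_le h0₂ h1₂ hL₂ hα0 hα1 v w
  have hl₃ : ∀ v w, ‖g₃ v - g₃ w‖ ≤ (4 * L + 16) * |v - w| := fun v w => by
    rw [hg₃, hg₃]; exact norm_rpow_mul_profileFn_sub_le h0₃ h1₃ hL₃ hα0 hα1 v w
  -- vanishing of `Gr` beyond the boxes
  have hg0 : ∀ {g : ℝ → ℂ} {c : ℤ → ℂ}, (∀ v, g v = (((v ^ (α - 1) : ℝ)) : ℂ) * profileFn c v) →
      ∀ v, 1 < v → g v = 0 := fun hg v hv => by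
    rw [hg, profileFn_of_not_mem (fun h => not_lt.mpr h.2 hv), mul_zero]
  have hGr0 : ∀ u₁ u₂ : ℝ, X₁ < u₁ ∨ X₂ < u₂ → Gr u₁ u₂ = 0 := by
    rintro u₁ u₂ (hu | hu)
    · rw [hGr, hg0 hg₁ _ ((one_lt_div hX₁).mpr hu)]
      simp
    · rw [hGr, hg0 hg₂ _ ((one_lt_div hX₂).mpr hu)]
      simp
  -- the blocks
  have hNK : ∀ n : ℕ, n ≤ t * (n / t + 1) := fun n => by
    rw [Nat.mul_succ]
    have h1 := Nat.div_add_mod n t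
    have h2 := Nat.mod_lt n ht
    generalize t * (n / t) = q at h1 ⊢
    omega
  have htK : ∀ n : ℕ, ((t * (n / t + 1) : ℕ) : ℝ) ≤ n + t := fun n => by
    have h : t * (n / t + 1) ≤ n + t := by
      rw [Nat.mul_succ]
      exact Nat.add_le_add_right (Nat.mul_div_le n t) t
    exact_mod_cast h
  set K₁ : ℕ := ⌊X₁⌋₊ / t + 1 with hK₁
  set K₂ : ℕ := ⌊X₂⌋₊ / t + 1 with hK₂
  -- both sides as double sums over ranges
  have hMC : parityModelCount σ d₁ d₂ X₁ X₂ X₃ Mv₁ Mv₂ Mv₃ α c₁ c₂ c₃ =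
      ∑ a ∈ range (t * K₁), ∑ b ∈ range (t * K₂), Gr ((a + 1 : ℕ) : ℝ) ((b + 1 : ℕ) : ℝ) := by
    rw [parityModelCount_eq_sum_sum_of_eq hg₁ hg₂ hg₃ hGr hX₃,
      sum_Icc_eq_sum_Icc_of_lt (N' := t * K₁) (hNK ⌊X₁⌋₊) ?_, sum_Icc_one_eq_sum_range]
    · refine Finset.sum_congr rfl fun a _ => ?_
      rw [sum_Icc_eq_sum_Icc_of_lt (N' := t * K₂) (hNK ⌊X₂⌋₊) ?_, sum_Icc_one_eq_sum_range]
      intro n₂ hn₂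
      exact hGr0 _ _ (Or.inr (Nat.lt_of_floor_lt hn₂))
    · intro n₁ hn₁
      exact Finset.sum_eq_zero fun n₂ _ => hGr0 _ _ (Or.inl (Nat.lt_of_floor_lt hn₁))
  have hSUB : (∑ n₁ ∈ (Icc 1 ⌊X₁⌋₊).filter (t ∣ ·), ∑ n₂ ∈ (Icc 1 ⌊X₂⌋₊).filter (t ∣ ·),
      ∑ n₃ ∈ (Icc 1 ⌊X₃⌋₊).filter (t ∣ ·),
        if (d₁ * n₁ : ℤ) + σ * (d₂ * n₂) = n₃ then
          profileModelWeight c₁ Mv₁ X₁ α n₁ * profileModelWeight c₂ Mv₂ X₂ α n₂ *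
            starRingEnd ℂ (profileModelWeight c₃ Mv₃ X₃ α n₃)
        else 0) =
      ∑ k₁ ∈ range K₁, ∑ k₂ ∈ range K₂,
        Gr ((t * k₁ + (t - 1) + 1 : ℕ) : ℝ) ((t * k₂ + (t - 1) + 1 : ℕ) : ℝ) := by
    rw [parityModel_sublattice_eq_sum_sum_of_eq hg₁ hg₂ hg₃ hGr hX₃ ht]
    have e : ∀ k : ℕ, t * k + (t - 1) + 1 = t * (k + 1) := fun k => by
      rw [add_assoc, Nat.sub_add_cancel (Nat.succ_le_of_lt ht), Nat.mul_succ]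
    simp only [e]
    rw [sum_Icc_eq_sum_Icc_of_lt (N' := K₁) (Nat.le_succ _) ?_, sum_Icc_one_eq_sum_range]
    · refine Finset.sum_congr rfl fun k₁ _ => ?_
      rw [sum_Icc_eq_sum_Icc_of_lt (N' := K₂) (Nat.le_succ _) ?_, sum_Icc_one_eq_sum_range]
      intro m₂ hm₂
      refine hGr0 _ _ (Or.inr (Nat.lt_of_floor_lt ?_))
      rw [mul_comm]
      exact (Nat.div_lt_iff_lt_mul ht).mp hm₂
    · intro m₁ hm₁
      refine Finset.sum_eq_zero fun m₂ _ => hGr0 _ _ (Or.inl (Nat.lt_of_floor_lt ?_))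
      rw [mul_comm]
      exact (Nat.div_lt_iff_lt_mul ht).mp hm₁
  -- oscillation of `Gr` on a block
  have hσ' : |(σ : ℝ)| ≤ 1 := by rcases hσ with rfl | rfl <;> simp
  have hB : ∀ a b : ℕ, ‖Gr ((a + 1 : ℕ) : ℝ) ((b + 1 : ℕ) : ℝ) -
      Gr ((t * (a / t) + (t - 1) + 1 : ℕ) : ℝ) ((t * (b / t) + (t - 1) + 1 : ℕ) : ℝ)‖ ≤
        Mv₁ / X₁ * (Mv₂ / X₂) * (Mv₃ / X₃) * (16 * (4 * L + 16) * t * (1 / X₁ + 1 / X₂ + (d₁ + d₂) / X₃)) := by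
    intro a b
    rw [hGr, hGr, ← mul_sub, norm_mul, Complex.norm_real, Real.norm_of_nonneg hP0]
    refine mul_le_mul_of_nonneg_left ?_ hP0
    exact norm_gTerm_sub_le (by positivity) hb₁ hb₂ hb₃ hl₁ hl₂ hl₃ hX₁ hX₂ hX₃ d₁ d₂ hσ'
      (abs_cast_sub_cast_blockRep_le a ht) (abs_cast_sub_cast_blockRep_le b ht)
  have hblock := norm_sum_sub_sq_mul_sum_le (fun a b => Gr ((a + 1 : ℕ) : ℝ) ((b + 1 : ℕ) : ℝ)) ht K₁ K₂ hB
  rw [norm_sub_rev, hMC, hSUB]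
  refine hblock.trans ?_
  -- bookkeeping of the constants
  have hK₁' : ((t * K₁ : ℕ) : ℝ) ≤ 2 * X₁ := (htK ⌊X₁⌋₊).trans (by linarith [Nat.floor_le hX₁.le])
  have hK₂' : ((t * K₂ : ℕ) : ℝ) ≤ 2 * X₂ := (htK ⌊X₂⌋₊).trans (by linarith [Nat.floor_le hX₂.le])
  have hS : 1 / X₁ + 1 / X₂ + (d₁ + d₂) / X₃ ≤ (d₁ + d₂ + 1) * (1 / X₁ + 1 / X₂ + 1 / X₃) := by
    have e : (d₁ + d₂ + 1) * (1 / X₁ + 1 / X₂ + 1 / X₃) - (1 / X₁ + 1 / X₂ + (d₁ + d₂) / X₃) =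
        (d₁ + d₂ : ℝ) * (1 / X₁ + 1 / X₂) + 1 / X₃ := by ring
    have h : 0 ≤ (d₁ + d₂ : ℝ) * (1 / X₁ + 1 / X₂) + 1 / X₃ := by positivity
    linarith
  have hLg : 4 * L + 16 ≤ 16 * (L + 1) := by linarith
  calc ((t * K₁ : ℕ) : ℝ) * ((t * K₂ : ℕ) : ℝ) *
        (Mv₁ / X₁ * (Mv₂ / X₂) * (Mv₃ / X₃) * (16 * (4 * L + 16) * t * (1 / X₁ + 1 / X₂ + (d₁ + d₂) / X₃)))
      ≤ (2 * X₁) * (2 * X₂) *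
        (Mv₁ / X₁ * (Mv₂ / X₂) * (Mv₃ / X₃) *
          (16 * (16 * (L + 1)) * t * ((d₁ + d₂ + 1) * (1 / X₁ + 1 / X₂ + 1 / X₃)))) := by
        gcongr
    _ = 1024 * (L + 1) * (d₁ + d₂ + 1) * t * (Mv₁ * Mv₂ * Mv₃ / X₃) * (1 / X₁ + 1 / X₂ + 1 / X₃) := by
        field_simp
        ring

/-- **(MC1) + (MC2): the rescaled model count.**  Under the hypotheses of
`norm_sq_mul_sublattice_sub_parityModelCount_le`, the model count at scales `X_i/t` with masses `Mv_i t^{−α}` is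
`t · (t^{−α})³ · (parityModelCount + O((L+1)(d₁+d₂+1) t (ΠMv_i/X₃)(1/X₁+1/X₂+1/X₃)))`, i.e. `≈ t^{1−3α}` times the
original one. [cite: Harper2016, §5] -/
theorem norm_parityModelCount_rescale_sub_le {σ : ℤ} (hσ : σ = 1 ∨ σ = -1) (d₁ d₂ : ℕ)
    {X₁ X₂ X₃ Mv₁ Mv₂ Mv₃ α L : ℝ} (hα0 : 0 ≤ α) (hα1 : α ≤ 1) (hMv₁ : 0 ≤ Mv₁) (hMv₂ : 0 ≤ Mv₂)
    (hMv₃ : 0 ≤ Mv₃) (hX₃ : 0 < X₃) {t : ℕ} (ht : 0 < t) (htX₁ : (t : ℝ) ≤ X₁) (htX₂ : (t : ℝ) ≤ X₂)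
    (h0₁ : ∀ v : ℝ, v ≤ 1 / 4 → profileFn c₁ v = 0) (h0₂ : ∀ v : ℝ, v ≤ 1 / 4 → profileFn c₂ v = 0)
    (h0₃ : ∀ v : ℝ, v ≤ 1 / 4 → profileFn c₃ v = 0)
    (h1₁ : ∀ v, ‖profileFn c₁ v‖ ≤ 1) (h1₂ : ∀ v, ‖profileFn c₂ v‖ ≤ 1) (h1₃ : ∀ v, ‖profileFn c₃ v‖ ≤ 1)
    (hL₁ : ∀ v w, ‖profileFn c₁ v - profileFn c₁ w‖ ≤ L * |v - w|)
    (hL₂ : ∀ v w, ‖profileFn c₂ v - profileFn c₂ w‖ ≤ L * |v - w|)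
    (hL₃ : ∀ v w, ‖profileFn c₃ v - profileFn c₃ w‖ ≤ L * |v - w|) :
    ‖parityModelCount σ d₁ d₂ (X₁ / t) (X₂ / t) (X₃ / t) (Mv₁ * (t : ℝ) ^ (-α)) (Mv₂ * (t : ℝ) ^ (-α))
          (Mv₃ * (t : ℝ) ^ (-α)) α c₁ c₂ c₃ -
        (t : ℂ) * (((t : ℝ) ^ (-α) : ℝ) : ℂ) ^ 3 * parityModelCount σ d₁ d₂ X₁ X₂ X₃ Mv₁ Mv₂ Mv₃ α c₁ c₂ c₃‖ ≤
      (t : ℝ) * ((t : ℝ) ^ (-α)) ^ 3 *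
        (1024 * (L + 1) * (d₁ + d₂ + 1) * t * (Mv₁ * Mv₂ * Mv₃ / X₃) * (1 / X₁ + 1 / X₂ + 1 / X₃)) := by
  rw [parityModelCount_rescale σ d₁ d₂ X₁ X₂ X₃ Mv₁ Mv₂ Mv₃ α c₁ c₂ c₃ ht,
    show ∀ S M : ℂ, (t : ℂ) ^ 3 * (((t : ℝ) ^ (-α) : ℝ) : ℂ) ^ 3 * S -
        (t : ℂ) * (((t : ℝ) ^ (-α) : ℝ) : ℂ) ^ 3 * M =
      (t : ℂ) * (((t : ℝ) ^ (-α) : ℝ) : ℂ) ^ 3 * ((t : ℂ) ^ 2 * S - M) from fun S M => by ring,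
    norm_mul, norm_mul, norm_pow, Complex.norm_natCast, Complex.norm_real,
    Real.norm_of_nonneg (Real.rpow_nonneg (Nat.cast_nonneg t) _)]
  exact mul_le_mul_of_nonneg_left (norm_sq_mul_sublattice_sub_parityModelCount_le hσ d₁ d₂ hα0 hα1 hMv₁ hMv₂
    hMv₃ hX₃ ht htX₁ htX₂ h0₁ h0₂ h0₃ h1₁ h1₂ h1₃ hL₁ hL₂ hL₃) (by positivity)

/-- `norm_parityModelCount_rescale_sub_le` with the masses written `t^{−α} Mv_i`. [cite: Harper2016, §5] -/
theorem norm_parityModelCount_rescale_sub_le' {σ : ℤ} (hσ : σ = 1 ∨ σ = -1) (d₁ d₂ : ℕ)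
    {X₁ X₂ X₃ Mv₁ Mv₂ Mv₃ α L : ℝ} (hα0 : 0 ≤ α) (hα1 : α ≤ 1) (hMv₁ : 0 ≤ Mv₁) (hMv₂ : 0 ≤ Mv₂)
    (hMv₃ : 0 ≤ Mv₃) (hX₃ : 0 < X₃) {t : ℕ} (ht : 0 < t) (htX₁ : (t : ℝ) ≤ X₁) (htX₂ : (t : ℝ) ≤ X₂)
    (h0₁ : ∀ v : ℝ, v ≤ 1 / 4 → profileFn c₁ v = 0) (h0₂ : ∀ v : ℝ, v ≤ 1 / 4 → profileFn c₂ v = 0)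
    (h0₃ : ∀ v : ℝ, v ≤ 1 / 4 → profileFn c₃ v = 0)
    (h1₁ : ∀ v, ‖profileFn c₁ v‖ ≤ 1) (h1₂ : ∀ v, ‖profileFn c₂ v‖ ≤ 1) (h1₃ : ∀ v, ‖profileFn c₃ v‖ ≤ 1)
    (hL₁ : ∀ v w, ‖profileFn c₁ v - profileFn c₁ w‖ ≤ L * |v - w|)
    (hL₂ : ∀ v w, ‖profileFn c₂ v - profileFn c₂ w‖ ≤ L * |v - w|)
    (hL₃ : ∀ v w, ‖profileFn c₃ v - profileFn c₃ w‖ ≤ L * |v - w|) :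
    ‖parityModelCount σ d₁ d₂ (X₁ / t) (X₂ / t) (X₃ / t) ((t : ℝ) ^ (-α) * Mv₁) ((t : ℝ) ^ (-α) * Mv₂)
          ((t : ℝ) ^ (-α) * Mv₃) α c₁ c₂ c₃ -
        (t : ℂ) * (((t : ℝ) ^ (-α) : ℝ) : ℂ) ^ 3 * parityModelCount σ d₁ d₂ X₁ X₂ X₃ Mv₁ Mv₂ Mv₃ α c₁ c₂ c₃‖ ≤
      (t : ℝ) * ((t : ℝ) ^ (-α)) ^ 3 *
        (1024 * (L + 1) * (d₁ + d₂ + 1) * t * (Mv₁ * Mv₂ * Mv₃ / X₃) * (1 / X₁ + 1 / X₂ + 1 / X₃)) := by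
  rw [mul_comm _ Mv₁, mul_comm _ Mv₂, mul_comm _ Mv₃]
  exact norm_parityModelCount_rescale_sub_le hσ d₁ d₂ hα0 hα1 hMv₁ hMv₂ hMv₃ hX₃ ht htX₁ htX₂ h0₁ h0₂ h0₃ h1₁ h1₂
    h1₃ hL₁ hL₂ hL₃

end SmoothArcs

end Literature.NumberTheory.Sieve

end
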